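import Summits.BirchSwinnertonDyer.BirchSwinnertonDyer.Theorems.ManinLocalTwoThreeGammaOneTowerUnitTwist

/-!
# E-es-111 (WITNESS FORM) BY VALUE: every rational newform has a 2-adic and a 3-adic Γ₁-WITNESS — an admissible odd-order twist whose
# Euler-corrected value is a unit against the Γ₁-plus period (cell bsd-f2-manin, MEMO-es §38.2/§38.5; seat `bsd-line-manin23-p2` gen 12)

Summit `BirchSwinnertonDyer`, route `ManinLocalTwoThree`, crux C2 `ManinOddAtFour` (stmt-BirchSwinnertonDyer-22967; v14 stub 6) and its `p = 3`
twin.  From the Γ₁ tower theorem `exists_primitive_even_gammaOneUnitTwistAt` (E-es-111♯ by value, …GammaOneTowerUnitTwist) by the typer's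
tower→witness conversion (`KatoCurve.twoAdicWitness_of_towerUnitTwist` / `threeAdicWitness_of_towerUnitTwist` pattern: a Dirichlet prime
`q ≡ 3 (mod 4)` resp. `q ≡ 2 (mod 3)` above `N + 3`, a level above the Wieferich level of `8` resp. `9` so that LEMMA W gives `χ(8) ≠ 1`
resp. `χ(3) ∉ {±1}`, odd order by `orderOf_odd_of_even`, `3 ∤ ord χ` by the group order):

* **`exists_twoAdicGammaOneWitness`** — for EVERY elliptic `V` and rational newform `f` with `IsNewformOf V f` (no optimality, no reduction
  type, NO plus-index hypothesis): `∃ m χ`, `(m, 2N) = 1`, `χ` primitive, `χ ≠ 1`, `2 ∤ ord χ`, `χ(8) ≠ 1`, and es's `GammaOneUnitTwistAt 2 V f χ`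
  body — i.e. es's `TwoAdicGammaOneWitness V f` by value, hence E-es-111 `TwoAdicGammaOneWitnessLaw` by value with all its binders idle;
* **`exists_threeAdicGammaOneWitness`** — the `p = 3` twin (`(m, 3N) = 1`, `3 ∤ ord χ`, `χ(3) ≠ ±1`, `χ` even, `GammaOneUnitTwistAt 3` body).

HONEST FRAMING (es §38.4): with E-es-111 a theorem, v14 stub 6 `GammaOneOddOnBlindClasses` ⟸ E-es-110 `KatoNeronIntegralTwoGamma1Optimal`
alone (es's `gammaOneOddOnBlindClasses_of_katoGamma1`, Sketch-es-g24 §3) — the Néron half, NOT in print at `E₁`, untouched here.  C2, Manin's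
conjecture and BSD are NOT proved by this file.  No definitions, no named facts, no sorry.
-/

set_option linter.dupNamespace false
set_option autoImplicit false

noncomputable section

open scoped Classical MatrixGroups ModularForm ComplexConjugate

open CongruenceSubgroup Complex Literature.NumberTheory.EllipticCurves
  Literature.NumberTheory.EllipticCurves.ModularForms
  Summit.BirchSwinnertonDyer.Rank1Residual.ManinAdditive.Gamma1Lattice
  Summit.BirchSwinnertonDyer.Rank1Residual.ManinAdditive.KatoCurve

namespace Summit.BirchSwinnertonDyer.BirchSwinnertonDyer.Theorems.ManinLocalTwoThree

/-- **E-es-111 BY VALUE at `p = 2`: every rational newform has a 2-adic Γ₁-witness.**  For `V` elliptic and `f` on `Γ₀(N)` with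
`IsNewformOf V f`: there are `m` prime to `2N` and a PRIMITIVE `χ ≠ 1` mod `m` of ODD order with `χ(8) ≠ 1` such that (es's
`GammaOneUnitTwistAt 2 V f χ`) for some `r` and some Γ₁-period `y` with `re y ≠ 0` generating `re Λ₁(f)`, the Euler-corrected twisted symbol
sum is `r·(2 re y)` with `s·r/2 ∉ ℤ̄` for every odd `s`. -/
theorem exists_twoAdicGammaOneWitness (V : WeierstrassCurve ℚ) [V.IsElliptic] {N : ℕ} [NeZero N] (f : CuspForm (Gamma0 N) 2)
    (hVf : IsNewformOf V f) :
    ∃ (m : ℕ) (_ : NeZero m) (χ : DirichletCharacter ℂ m),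
      m.Coprime (2 * N) ∧ χ.IsPrimitive ∧ χ ≠ 1 ∧ ¬ 2 ∣ orderOf χ ∧ χ (8 : ZMod m) ≠ 1 ∧
      ∃ (r : ℂ) (y : ℂ), y ∈ periodLatticeGamma1 f ∧ y.re ≠ 0 ∧
        (∀ x ∈ periodLatticeGamma1 f, ∃ j : ℤ, x.re = j * y.re) ∧
        (∏ ℓ ∈ N.primeFactors with ¬ ℓ ^ 2 ∣ N,
            (((ℓ : ℂ) - (V.LFunction ℓ : ℂ) * χ (ℓ : ZMod m)) *
              ((ℓ : ℂ) - (V.LFunction ℓ : ℂ) * (χ (ℓ : ZMod m))⁻¹))) *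
            twistedSymbolSum f χ = r * ((2 * y.re : ℝ) : ℂ) ∧
        ∀ s : ℕ, ¬ 2 ∣ s → ¬ IsIntegral ℤ ((s : ℂ) * r / 2) := by
  classical
  obtain ⟨q, hqgt, hq, hqmod⟩ :=
    Nat.forall_exists_prime_gt_and_modEq (N + 3) (q := 4) (a := 3) (by norm_num) (by norm_num)
  haveI hqF : Fact q.Prime := ⟨hq⟩
  have hNpos : 0 < N := Nat.pos_of_ne_zero (NeZero.ne N)
  have hqN : ¬ q ∣ N := fun h => by have := Nat.le_of_dvd hNpos h; omega
  have hq2 : q ≠ 2 := by omega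
  have hmod' : q % 4 = 3 := hqmod
  have h2q : ¬ 2 ∣ (q - 1) / 2 := by omega
  obtain ⟨n, hn, χ, hprim, heven, r, y, hy, hyre, hygen, hr, hunit⟩ :=
    exists_primitive_even_gammaOneUnitTwistAt Nat.prime_two V f hVf q hq2 hq2 hqN h2q (padicValNat q (8 ^ (q - 1) - 1) + 1)
  haveI : NeZero (q ^ n) := ⟨pow_ne_zero n hq.ne_zero⟩
  have hn0 : 0 < n := by omega
  have hq8 : ¬ q ∣ 8 := by
    intro h
    have h' : q ∣ 2 ^ 3 := by simpa using h
    have := (Nat.prime_dvd_prime_iff_eq hq Nat.prime_two).1 (hq.dvd_of_dvd_pow h')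
    omega
  have hW8 : χ ((8 : ℕ) : ZMod (q ^ n)) ≠ 1 :=
    wieferichLevel_holds q 8 n hq hq2 (by norm_num) hq8 (by omega) χ hprim
  have hc8 : χ (8 : ZMod (q ^ n)) ≠ 1 := by simpa using hW8
  have hord : ¬ 2 ∣ orderOf χ := orderOf_odd_of_even hq hq2 hn0 h2q χ heven
  have hcop : (q ^ n).Coprime (2 * N) := by
    apply Nat.Coprime.pow_left
    exact Nat.Coprime.mul_right ((Nat.coprime_primes hq Nat.prime_two).2 hq2)
      ((Nat.Prime.coprime_iff_not_dvd hq).2 hqN)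
  have hne1 : χ ≠ 1 := by
    intro h1
    have hc : χ.conductor = 1 := (DirichletCharacter.eq_one_iff_conductor_eq_one).1 h1
    have hc' : χ.conductor = q ^ n := hprim
    have : 1 < q ^ n := Nat.one_lt_pow (by omega) hq.one_lt
    omega
  refine ⟨q ^ n, inferInstance, χ, hcop, hprim, hne1, hord, hc8, r, y, hy, hyre, hygen, hr, ?_⟩
  intro s hs
  simpa using hunit s hs

/-- **E-es-111 BY VALUE at `p = 3`: every rational newform has a 3-adic Γ₁-witness** (`(m, 3N) = 1`, `χ` primitive even, `χ ≠ 1`,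
`3 ∤ ord χ`, `χ(3) ∉ {±1}`, and es's `GammaOneUnitTwistAt 3 V f χ` body). -/
theorem exists_threeAdicGammaOneWitness (V : WeierstrassCurve ℚ) [V.IsElliptic] {N : ℕ} [NeZero N] (f : CuspForm (Gamma0 N) 2)
    (hVf : IsNewformOf V f) :
    ∃ (m : ℕ) (_ : NeZero m) (χ : DirichletCharacter ℂ m),
      m.Coprime (3 * N) ∧ χ.IsPrimitive ∧ χ ≠ 1 ∧ ¬ 3 ∣ orderOf χ ∧ χ (3 : ZMod m) ≠ 1 ∧ χ (3 : ZMod m) ≠ -1 ∧ χ.Even ∧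
      ∃ (r : ℂ) (y : ℂ), y ∈ periodLatticeGamma1 f ∧ y.re ≠ 0 ∧
        (∀ x ∈ periodLatticeGamma1 f, ∃ j : ℤ, x.re = j * y.re) ∧
        (∏ ℓ ∈ N.primeFactors with ¬ ℓ ^ 2 ∣ N,
            (((ℓ : ℂ) - (V.LFunction ℓ : ℂ) * χ (ℓ : ZMod m)) *
              ((ℓ : ℂ) - (V.LFunction ℓ : ℂ) * (χ (ℓ : ZMod m))⁻¹))) *
            twistedSymbolSum f χ = r * ((2 * y.re : ℝ) : ℂ) ∧
        ∀ s : ℕ, ¬ 3 ∣ s → ¬ IsIntegral ℤ ((s : ℂ) * r / 3) := by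
  classical
  obtain ⟨q, hqgt, hq, hqmod⟩ :=
    Nat.forall_exists_prime_gt_and_modEq (N + 3) (q := 3) (a := 2) (by norm_num) (by norm_num)
  haveI hqF : Fact q.Prime := ⟨hq⟩
  have hNpos : 0 < N := Nat.pos_of_ne_zero (NeZero.ne N)
  have hqN : ¬ q ∣ N := fun h => by have := Nat.le_of_dvd hNpos h; omega
  have hq2 : q ≠ 2 := by omega
  have hq3 : q ≠ 3 := by omega
  have hmod' : q % 3 = 2 := hqmod
  have hqodd : ¬ 2 ∣ q := fun h => by
    rcases hq.eq_one_or_self_of_dvd 2 h with h | h <;> omega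
  have h3q : ¬ 3 ∣ (q - 1) / 2 := by omega
  obtain ⟨n, hn, χ, hprim, heven, r, y, hy, hyre, hygen, hr, hunit⟩ :=
    exists_primitive_even_gammaOneUnitTwistAt Nat.prime_three V f hVf q hq2 hq3 hqN h3q (padicValNat q (9 ^ (q - 1) - 1) + 1)
  haveI : NeZero (q ^ n) := ⟨pow_ne_zero n hq.ne_zero⟩
  have hn0 : 0 < n := by omega
  have hq9 : ¬ q ∣ 9 := by
    intro h
    have h' : q ∣ 3 ^ 2 := by simpa using h
    have := (Nat.prime_dvd_prime_iff_eq hq Nat.prime_three).1 (hq.dvd_of_dvd_pow h')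
    omega
  have hW9 : χ ((9 : ℕ) : ZMod (q ^ n)) ≠ 1 :=
    wieferichLevel_holds q 9 n hq hq2 (by norm_num) hq9 (by omega) χ hprim
  have h9cast : ((9 : ℕ) : ZMod (q ^ n)) = (3 : ZMod (q ^ n)) ^ 2 := by norm_num
  rw [h9cast, map_pow] at hW9
  have hc3a : χ (3 : ZMod (q ^ n)) ≠ 1 := fun h => hW9 (by rw [h, one_pow])
  have hc3b : χ (3 : ZMod (q ^ n)) ≠ -1 := fun h => hW9 (by rw [h, neg_one_sq])
  have hord : ¬ 3 ∣ orderOf χ := by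
    intro h3
    have hdvd := dvd_trans h3 (orderOf_dvd_card_units χ)
    rw [ZMod.card_units_eq_totient, Nat.totient_prime_pow hq hn0] at hdvd
    rcases (Nat.Prime.dvd_mul Nat.prime_three).1 hdvd with h | h
    · have := (Nat.prime_dvd_prime_iff_eq Nat.prime_three hq).1 (Nat.prime_three.dvd_of_dvd_pow h)
      omega
    · omega
  have hcop : (q ^ n).Coprime (3 * N) := by
    apply Nat.Coprime.pow_left
    exact Nat.Coprime.mul_right ((Nat.coprime_primes hq Nat.prime_three).2 hq3)
      ((Nat.Prime.coprime_iff_not_dvd hq).2 hqN)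
  have hne1 : χ ≠ 1 := by
    intro h1
    have hc : χ.conductor = 1 := (DirichletCharacter.eq_one_iff_conductor_eq_one).1 h1
    have hc' : χ.conductor = q ^ n := hprim
    have : 1 < q ^ n := Nat.one_lt_pow (by omega) hq.one_lt
    omega
  refine ⟨q ^ n, inferInstance, χ, hcop, hprim, hne1, hord, hc3a, hc3b, heven, r, y, hy, hyre, hygen, hr, ?_⟩
  intro s hs
  simpa using hunit s hs

end Summit.BirchSwinnertonDyer.BirchSwinnertonDyer.Theorems.ManinLocalTwoThree

end
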